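import Summits.QuantumFields.YangMills.Theorems.QuantileBitPurityGAxisDefs
import Summits.QuantumFields.YangMills.Theorems.QuantileBitPurityGAxisComb
import HarnessLib

/-!
# The seam-axis transported field: unit axis, size, and the edge ∕ seam defects in terms of three commutators

Support module (`--supports` stmt-QuantumFields-23948, `QuantileBitPurity.HolonomyQuantileSubQuartic`; seat ym-dw-p1 g16, plan HOME
`bc/g15-dw/PLAN-CORE-GAXIS.md`, modules A1 + B1).  For the field `h = gAxisField θ χ₀ σ₁ g U` of the defs module `QuantileBitPurityGAxisDefs`
(`h x = W_x⁻¹ h₀ W_x`, `W_x = sheetTransport U x` the comb transport, `h₀ = gAxisElt θ χ₀ σ₁ g U = exp(ι θ a)` with the axis rule `a = gAxis …`) we prove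
(`q = su2Quat`, `P_y = lineHolonomy U 1 L 0`, `P_z = lineHolonomy U 2 L 0`, `g₀ = g 0`):

* §1 the axis is a unit vector (`χ₀, σ₁ > 0`), `h 0 = h₀`, `‖q_{h₀} − 1‖ ≤ |θ|`, and `vacDist h₀ ≥ (4/3)θ` for `0 ≤ θ ≤ 1` (the core moves out);
* §2 ★ the THREE COMMUTATORS of `h₀` by the axis rule: `‖[q_{h₀}, q_{g₀}]‖ ≤ 2χ₀|θ|` and, given `‖[q_{g₀}, q_{P_μ}]‖ ≤ A` (`μ = y, z`) and
  `‖[q_{P_y}, q_{P_z}]‖ ≤ B`, `‖[q_{h₀}, q_{P_μ}]‖ ≤ |θ| (A/χ₀ + B/σ₁ + 2σ₁)` (coaxial identity of `QuantileBitPurityGAxisQuat` in each regime);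
* §3 ★ the EDGE DEFECT of `h` on any slice `U'` whose links are `ν`-close to those of `U`:
  `‖q(h x) − q(U'(x,j) h(x+e_j) U'(x,j)⁻¹)‖ ≤ max_μ ‖[q_{h₀}, q_{P_μ}]‖ + 2(L²ε + ν)|θ|` (comb links of `QuantileBitPurityGAxisComb`), and the SEAM DEFECT
  `‖q(h x) − q(g(x) h(x) g(x)⁻¹)‖ ≤ ‖[q_{h₀}, q_{g₀}]‖ + 4Lτ|θ|` when `g · U` is linkwise `τ`-close to `U` (seam-field transport of `QuantileBitPurityGAxisLadder`).

HONEST FRAMING: fixed-lattice bookkeeping; nothing about infinite volume, the continuum limit or the Clay gap.  No `sorry`, no new axiom, no new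
definition.  References: [cite: Luscher1983, §2]; [cite: tHooft1979].
-/

set_option autoImplicit false

noncomputable section

open scoped Quaternion BigOperators
open NormedSpace Function
open Literature.MathematicalPhysics.QuantumLattice (su2Quat su2Quat_ne_zero norm_su2Quat)
open Literature.MathematicalPhysics.QuantumFieldTheory hiding su2Quat_mul
open Literature.MathematicalPhysics.QuantumFieldTheory.Balaban1983to89.T4HaarSU2ExpChart (expPoint expPoint_zero)
open Literature.MathematicalPhysics.QuantumFieldTheory.Balaban1983to89.T4HaarSU2Translate (su2Quat_mul su2Quat_one)

namespace Summit.QuantumFields.YangMills.Theorems.FemtoTransferGap.GAxis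

open ClassShift OwnAxis

variable {L : ℕ}

/-! ## §1 Unit axis, the value at the origin, the size of `h₀` -/

/-- The axis rule returns a unit vector (`χ₀, σ₁ > 0`). [folklore] -/
theorem norm_gAxis_eq_one {χ₀ σ₁ : ℝ} (hχ : 0 < χ₀) (hσ : 0 < σ₁) (g₀ P₁ P₂ : SU2) : ‖gAxis χ₀ σ₁ g₀ P₁ P₂‖ = 1 := by
  have hne : ∀ {W : SU2} {c : ℝ}, 0 < c → c ≤ ‖imVec (su2Quat W)‖ → imVec (su2Quat W) ≠ 0 := fun hc hcW h => by
    rw [h, norm_zero] at hcW; linarith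
  rw [gAxis_def]
  split_ifs with h1 h2 h3
  · exact norm_axisVec_eq_one (hne hχ h1)
  · exact norm_axisVec_eq_one (hne hσ h2)
  · exact norm_axisVec_eq_one (hne hσ h3)
  · simp

variable [NeZero L]

omit [NeZero L] in
/-- The comb transport to the origin is trivial. [folklore] -/
theorem sheetTransport_zero (U : GaugeConfig 3 L SU2) : sheetTransport U 0 = 1 := by
  rw [sheetTransport_def]
  simp

omit [NeZero L] in
/-- ★ The field at the origin is the reference rotation: `h 0 = h₀`. [folklore] -/
theorem gAxisField_zero (θ χ₀ σ₁ : ℝ) (g : Site 3 L → SU2) (U : GaugeConfig 3 L SU2) :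
    gAxisField θ χ₀ σ₁ g U 0 = gAxisElt θ χ₀ σ₁ g U := by
  rw [gAxisField_apply, sheetTransport_zero, inv_one, one_mul, mul_one]

omit [NeZero L] in
/-- `‖q_{h₀} − 1‖ ≤ |θ|`. [folklore] -/
theorem norm_su2Quat_gAxisElt_sub_one_le (θ : ℝ) {χ₀ σ₁ : ℝ} (hχ : 0 < χ₀) (hσ : 0 < σ₁) (g : Site 3 L → SU2) (U : GaugeConfig 3 L SU2) :
    ‖su2Quat (gAxisElt θ χ₀ σ₁ g U) - 1‖ ≤ |θ| := by
  rw [gAxisElt_def]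
  exact norm_su2Quat_expPoint_sub_one_le (norm_gAxis_eq_one hχ hσ _ _ _) θ

omit [NeZero L] in
/-- `‖q_{h x} − 1‖ ≤ |θ|` at every site (conjugation does not change the distance to `1`). [folklore] -/
theorem norm_su2Quat_gAxisField_sub_one_le (θ : ℝ) {χ₀ σ₁ : ℝ} (hχ : 0 < χ₀) (hσ : 0 < σ₁) (g : Site 3 L → SU2) (U : GaugeConfig 3 L SU2)
    (x : Site 3 L) : ‖su2Quat (gAxisField θ χ₀ σ₁ g U x) - 1‖ ≤ |θ| := by
  rw [gAxisField_apply]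
  have h := norm_su2Quat_conj_sub_conj (sheetTransport U x) (gAxisElt θ χ₀ σ₁ g U) 1
  rw [mul_one, inv_mul_cancel, su2Quat_one] at h
  rw [h]
  exact norm_su2Quat_gAxisElt_sub_one_le θ hχ hσ g U

omit [NeZero L] in
/-- ★ **The core moves out**: `vacDist h₀ ≥ (4/3) θ` for `0 ≤ θ ≤ 1`. [folklore] -/
theorem vacDist_gAxisElt_ge {θ χ₀ σ₁ : ℝ} (h0 : 0 ≤ θ) (h1 : θ ≤ 1) (hχ : 0 < χ₀) (hσ : 0 < σ₁) (g : Site 3 L → SU2) (U : GaugeConfig 3 L SU2) :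
    4 / 3 * θ ≤ vacDist (gAxisElt θ χ₀ σ₁ g U) := by
  rw [gAxisElt_def]
  exact vacDist_expPoint_ge (norm_gAxis_eq_one hχ hσ _ _ _) h0 h1

/-! ## §2 The three commutators of `h₀` by the axis rule -/

omit [NeZero L] in
/-- ★ **Seam commutator**: `‖q_{h₀} q_{g₀} − q_{g₀} q_{h₀}‖ ≤ 2 χ₀ |θ|` (zero when the seam field is `χ₀`-non-central, since then `h₀` is coaxial with it).
[cite: Luscher1983, §2] -/
theorem norm_comm_gAxisElt_seam_le (θ : ℝ) {χ₀ σ₁ : ℝ} (hχ : 0 < χ₀) (hσ : 0 < σ₁) (g : Site 3 L → SU2) (U : GaugeConfig 3 L SU2) :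
    ‖su2Quat (gAxisElt θ χ₀ σ₁ g U) * su2Quat (g 0) - su2Quat (g 0) * su2Quat (gAxisElt θ χ₀ σ₁ g U)‖ ≤ 2 * χ₀ * |θ| := by
  have hθ : ‖su2Quat (gAxisElt θ χ₀ σ₁ g U) - 1‖ ≤ |θ| := norm_su2Quat_gAxisElt_sub_one_le θ hχ hσ g U
  by_cases h1 : χ₀ ≤ ‖imVec (su2Quat (g 0))‖
  · have hax : gAxis χ₀ σ₁ (g 0) (lineHolonomy U 1 L 0) (lineHolonomy U 2 L 0) = axisVec (g 0) := by rw [gAxis_def, if_pos h1]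
    rw [gAxisElt_def, hax, ← norm_neg, neg_sub, comm_rot_self, norm_zero]; positivity
  · have h1' : ‖imVec (su2Quat (g 0))‖ ≤ χ₀ := (not_le.mp h1).le
    calc _ ≤ 2 * ‖imVec (su2Quat (g 0))‖ * ‖su2Quat (gAxisElt θ χ₀ σ₁ g U) - 1‖ := norm_comm_su2Quat_le' (g 0) _
      _ ≤ 2 * χ₀ * |θ| := by gcongr

omit [NeZero L] in
/-- ★ **Loop commutators**: if `‖q_{g₀} q_{P_μ} − q_{P_μ} q_{g₀}‖ ≤ A` for `μ = y, z` and `‖q_{P_y} q_{P_z} − q_{P_z} q_{P_y}‖ ≤ B` (`A, B ≥ 0`), then for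
`P ∈ {P_y, P_z}`: `‖q_{h₀} q_P − q_P q_{h₀}‖ ≤ |θ| (A/χ₀ + B/σ₁ + 2σ₁)`. [cite: Luscher1983, §2] -/
theorem norm_comm_gAxisElt_loop_le (θ : ℝ) {χ₀ σ₁ A B : ℝ} (hχ : 0 < χ₀) (hσ : 0 < σ₁) (hA : 0 ≤ A) (hB : 0 ≤ B)
    (g : Site 3 L → SU2) (U : GaugeConfig 3 L SU2)
    (hgy : ‖su2Quat (g 0) * su2Quat (lineHolonomy U 1 L 0) - su2Quat (lineHolonomy U 1 L 0) * su2Quat (g 0)‖ ≤ A)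
    (hgz : ‖su2Quat (g 0) * su2Quat (lineHolonomy U 2 L 0) - su2Quat (lineHolonomy U 2 L 0) * su2Quat (g 0)‖ ≤ A)
    (hyz : ‖su2Quat (lineHolonomy U 1 L 0) * su2Quat (lineHolonomy U 2 L 0) - su2Quat (lineHolonomy U 2 L 0) * su2Quat (lineHolonomy U 1 L 0)‖ ≤ B) :
    ‖su2Quat (gAxisElt θ χ₀ σ₁ g U) * su2Quat (lineHolonomy U 1 L 0) - su2Quat (lineHolonomy U 1 L 0) * su2Quat (gAxisElt θ χ₀ σ₁ g U)‖ ≤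
        |θ| * (A / χ₀ + B / σ₁ + 2 * σ₁) ∧
      ‖su2Quat (gAxisElt θ χ₀ σ₁ g U) * su2Quat (lineHolonomy U 2 L 0) - su2Quat (lineHolonomy U 2 L 0) * su2Quat (gAxisElt θ χ₀ σ₁ g U)‖ ≤
        |θ| * (A / χ₀ + B / σ₁ + 2 * σ₁) := by
  have hθ1 : ‖su2Quat (gAxisElt θ χ₀ σ₁ g U) - 1‖ ≤ |θ| := norm_su2Quat_gAxisElt_sub_one_le θ hχ hσ g U
  set Py := lineHolonomy U 1 L 0 with hPy
  set Pz := lineHolonomy U 2 L 0 with hPz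
  have hθ0 : 0 ≤ |θ| := abs_nonneg θ
  have hK0' : 0 ≤ A / χ₀ + B / σ₁ + 2 * σ₁ := by positivity
  have hK1 : |θ| / χ₀ * A ≤ |θ| * (A / χ₀ + B / σ₁ + 2 * σ₁) := by
    rw [div_mul_eq_mul_div, mul_div_assoc]
    exact mul_le_mul_of_nonneg_left (by linarith [div_nonneg hB hσ.le, hσ.le]) hθ0
  have hK2 : |θ| / σ₁ * B ≤ |θ| * (A / χ₀ + B / σ₁ + 2 * σ₁) := by
    rw [div_mul_eq_mul_div, mul_div_assoc]
    exact mul_le_mul_of_nonneg_left (by linarith [div_nonneg hA hχ.le, hσ.le]) hθ0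
  have hK3 : 2 * σ₁ * |θ| ≤ |θ| * (A / χ₀ + B / σ₁ + 2 * σ₁) := by
    rw [mul_comm]
    exact mul_le_mul_of_nonneg_left (by linarith [div_nonneg hA hχ.le, div_nonneg hB hσ.le]) hθ0
  have hK0 : 0 ≤ |θ| * (A / χ₀ + B / σ₁ + 2 * σ₁) := by positivity
  have hyz' : ‖su2Quat Pz * su2Quat Py - su2Quat Py * su2Quat Pz‖ ≤ B := by rw [← norm_neg, neg_sub]; exact hyz
  -- near-central loops commute with anything close to `1`
  have hnc : ∀ {P : SU2}, ‖imVec (su2Quat P)‖ ≤ σ₁ →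
      ‖su2Quat (gAxisElt θ χ₀ σ₁ g U) * su2Quat P - su2Quat P * su2Quat (gAxisElt θ χ₀ σ₁ g U)‖ ≤ |θ| * (A / χ₀ + B / σ₁ + 2 * σ₁) := by
    intro P hP
    calc _ ≤ 2 * ‖imVec (su2Quat P)‖ * ‖su2Quat (gAxisElt θ χ₀ σ₁ g U) - 1‖ := norm_comm_su2Quat_le' P _
      _ ≤ 2 * σ₁ * |θ| := by gcongr
      _ ≤ _ := hK3
  by_cases h1 : χ₀ ≤ ‖imVec (su2Quat (g 0))‖
  · -- regime G1: coaxial with the seam field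
    have hax : gAxis χ₀ σ₁ (g 0) Py Pz = axisVec (g 0) := by rw [gAxis_def, if_pos h1]
    rw [gAxisElt_def, ← hPy, ← hPz, hax]
    exact ⟨(norm_comm_rot_le' θ hχ h1 _).trans ((mul_le_mul_of_nonneg_left hgy (by positivity)).trans hK1),
      (norm_comm_rot_le' θ hχ h1 _).trans ((mul_le_mul_of_nonneg_left hgz (by positivity)).trans hK1)⟩
  · by_cases h2 : σ₁ ≤ ‖imVec (su2Quat Py)‖
    · -- regime Gy: coaxial with `P_y`
      have hax : gAxis χ₀ σ₁ (g 0) Py Pz = axisVec Py := by rw [gAxis_def, if_neg h1, if_pos h2]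
      rw [gAxisElt_def, ← hPy, ← hPz, hax]
      refine ⟨?_, ?_⟩
      · rw [← norm_neg, neg_sub, comm_rot_self, norm_zero]; exact hK0
      · exact (norm_comm_rot_le' θ hσ h2 _).trans ((mul_le_mul_of_nonneg_left hyz (by positivity)).trans hK2)
    · have h2' : ‖imVec (su2Quat Py)‖ ≤ σ₁ := (not_le.mp h2).le
      by_cases h3 : σ₁ ≤ ‖imVec (su2Quat Pz)‖
      · -- regime Gz: coaxial with `P_z`
        have hax : gAxis χ₀ σ₁ (g 0) Py Pz = axisVec Pz := by rw [gAxis_def, if_neg h1, if_neg h2, if_pos h3]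
        refine ⟨hnc h2', ?_⟩
        rw [gAxisElt_def, ← hPy, ← hPz, hax, ← norm_neg, neg_sub, comm_rot_self, norm_zero]; exact hK0
      · -- regime G00: everything near-central
        exact ⟨hnc h2', hnc (not_le.mp h3).le⟩

/-! ## §3 The edge and seam defects of the transported field -/

omit [NeZero L] in
/-- **The edge defect is a commutator with a comb link of the slice**: for `h = gAxisField θ χ₀ σ₁ g U` and any slice `U'`,
`‖q(h x) − q(U'(x,j) h(x+e_j) U'(x,j)⁻¹)‖ = ‖q_{h₀} q_{V'} − q_{V'} q_{h₀}‖`, `V' = W_x U'(x,j) W_{x+e_j}⁻¹`. [folklore] -/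
theorem norm_edgeDefect_eq (θ χ₀ σ₁ : ℝ) (g : Site 3 L → SU2) (U U' : GaugeConfig 3 L SU2) (x : Site 3 L) (j : Fin 3) :
    ‖su2Quat (gAxisField θ χ₀ σ₁ g U x) - su2Quat (U' (x, j) * gAxisField θ χ₀ σ₁ g U (x.shift j) * (U' (x, j))⁻¹)‖ =
      ‖su2Quat (gAxisElt θ χ₀ σ₁ g U) * su2Quat (sheetTransport U x * U' (x, j) * (sheetTransport U (x.shift j))⁻¹) -
        su2Quat (sheetTransport U x * U' (x, j) * (sheetTransport U (x.shift j))⁻¹) * su2Quat (gAxisElt θ χ₀ σ₁ g U)‖ := by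
  have e1 : U' (x, j) * gAxisField θ χ₀ σ₁ g U (x.shift j) * (U' (x, j))⁻¹ =
      (sheetTransport U x)⁻¹ * ((sheetTransport U x * U' (x, j) * (sheetTransport U (x.shift j))⁻¹) * gAxisElt θ χ₀ σ₁ g U *
        (sheetTransport U x * U' (x, j) * (sheetTransport U (x.shift j))⁻¹)⁻¹) * sheetTransport U x := by
    rw [gAxisField_apply]; group
  rw [gAxisField_apply, e1, norm_su2Quat_conj_sub_conj, norm_sub_conj_eq_norm_comm]

/-- ★ **Edge defect bound**: with plaquettes of `U` within `ε` of `1`, links of `U'` within `ν` of those of `U`, and `M` a bound for the two loop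
commutators `‖[q_{h₀}, q_{P_μ}]‖`, every edge defect of `h` on `U'` is at most `M + 2(L²ε)|θ| + 2ν|θ|` (`χ₀, σ₁ > 0`). [cite: Luscher1983, §2] -/
theorem norm_edgeDefect_le (θ : ℝ) {χ₀ σ₁ ε ν M : ℝ} (hχ : 0 < χ₀) (hσ : 0 < σ₁) (g : Site 3 L → SU2) {U U' : GaugeConfig 3 L SU2}
    (hP : ∀ (y : Site 3 L) (i j : Fin 3), ‖su2Quat (plaquetteHolonomy U y i j) - 1‖ ≤ ε)
    (hν : ∀ e : Edge 3 L, ‖su2Quat (U' e) - su2Quat (U e)‖ ≤ ν)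
    (hMy : ‖su2Quat (gAxisElt θ χ₀ σ₁ g U) * su2Quat (lineHolonomy U 1 L 0) - su2Quat (lineHolonomy U 1 L 0) * su2Quat (gAxisElt θ χ₀ σ₁ g U)‖ ≤ M)
    (hMz : ‖su2Quat (gAxisElt θ χ₀ σ₁ g U) * su2Quat (lineHolonomy U 2 L 0) - su2Quat (lineHolonomy U 2 L 0) * su2Quat (gAxisElt θ χ₀ σ₁ g U)‖ ≤ M)
    {x : Site 3 L} (hx : x 0 = 0) {j : Fin 3} (hj : j ≠ 0) :
    ‖su2Quat (gAxisField θ χ₀ σ₁ g U x) - su2Quat (U' (x, j) * gAxisField θ χ₀ σ₁ g U (x.shift j) * (U' (x, j))⁻¹)‖ ≤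
      M + 2 * (L * (L * ε)) * |θ| + 2 * ν * |θ| := by
  rw [norm_edgeDefect_eq]
  set W := sheetTransport U x with hW
  set W' := sheetTransport U (x.shift j) with hW'
  set h₀ := gAxisElt θ χ₀ σ₁ g U with hh₀
  set V' := W * U' (x, j) * W'⁻¹ with hV'
  set V := W * U (x, j) * W'⁻¹ with hV
  have hθ1 : ‖su2Quat h₀ - 1‖ ≤ |θ| := norm_su2Quat_gAxisElt_sub_one_le θ hχ hσ g U
  -- the comb link of `U` itself
  have hcomb : ‖su2Quat h₀ * su2Quat V - su2Quat V * su2Quat h₀‖ ≤ M + 2 * (L * (L * ε)) * ‖su2Quat h₀ - 1‖ := by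
    have h := norm_comm_combLink_le hP h₀ hx hj
    rw [← sheetTransport_def, ← sheetTransport_def, ← hW, ← hW', ← hV] at h
    exact h.trans (add_le_add (max_le hMy hMz) le_rfl)
  -- from `U` to `U'`: `‖q_{V'} − q_V‖ = ‖q(U'(x,j)) − q(U(x,j))‖ ≤ ν`
  have hVV : ‖su2Quat V' - su2Quat V‖ ≤ ν := by
    have e : su2Quat V' - su2Quat V = su2Quat W * (su2Quat (U' (x, j)) - su2Quat (U (x, j))) * su2Quat W'⁻¹ := by
      rw [hV', hV, su2Quat_mul, su2Quat_mul, su2Quat_mul, su2Quat_mul]; noncomm_ring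
    rw [e, norm_mul, norm_mul, norm_su2Quat, norm_su2Quat, one_mul, mul_one]
    exact hν (x, j)
  have hdiff := norm_comm_sub_comm_le' (su2Quat V') (su2Quat V) (su2Quat h₀)
  have h1 : ‖su2Quat h₀ * su2Quat V' - su2Quat V' * su2Quat h₀‖ ≤
      ‖su2Quat h₀ * su2Quat V - su2Quat V * su2Quat h₀‖ + 2 * ‖su2Quat V' - su2Quat V‖ * ‖su2Quat h₀ - 1‖ := by
    have h := norm_add_le (su2Quat h₀ * su2Quat V - su2Quat V * su2Quat h₀)
      ((su2Quat h₀ * su2Quat V' - su2Quat V' * su2Quat h₀) - (su2Quat h₀ * su2Quat V - su2Quat V * su2Quat h₀))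
    rw [add_sub_cancel] at h
    exact h.trans (add_le_add le_rfl hdiff)
  have h2 : 2 * ‖su2Quat V' - su2Quat V‖ * ‖su2Quat h₀ - 1‖ ≤ 2 * ν * |θ| :=
    mul_le_mul (mul_le_mul_of_nonneg_left hVV (by norm_num)) hθ1 (norm_nonneg _) (by linarith [norm_nonneg (su2Quat V' - su2Quat V)])
  have hε : 0 ≤ ε := (norm_nonneg _).trans (hP 0 0 1)
  have h3 : 2 * (L * (L * ε)) * ‖su2Quat h₀ - 1‖ ≤ 2 * (L * (L * ε)) * |θ| := mul_le_mul_of_nonneg_left hθ1 (by positivity)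
  linarith

/-- **The seam field at a plane site vs its comb transport from the origin**: if `g · U` is linkwise `τ`-close to `U`, then
`‖q(g x) − q(W_x⁻¹ g₀ W_x)‖ ≤ 2Lτ` for every plane site `x`. [cite: Luscher1983, §2] -/
theorem norm_seamField_sub_transport_le {U : GaugeConfig 3 L SU2} {g : Site 3 L → SU2} {τ : ℝ}
    (hG : ∀ e : Edge 3 L, ‖su2Quat (gaugeTransform g U e) - su2Quat (U e)‖ ≤ τ) {x : Site 3 L} (hx : x 0 = 0) :
    ‖su2Quat (g x) - su2Quat ((sheetTransport U x)⁻¹ * g 0 * sheetTransport U x)‖ ≤ 2 * (L * τ) := by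
  have hτ : 0 ≤ τ := (norm_nonneg _).trans (hG ((0 : Site 3 L), 0))
  rw [sheetTransport_def]
  set C := lineHolonomy U 2 (x 2).val 0 with hC
  set b : Site 3 L := Pi.single 2 (x 2) with hb
  set R := lineHolonomy U 1 (x 1).val b with hR
  -- column: origin → b
  have hcol := norm_su2Quat_seamField_transport_sub_le hG 2 (x 2).val (0 : Site 3 L)
  rw [iterate_shift_dir_eq, column_base_eq, ← hb, ← hC] at hcol
  -- row: b → x
  have hrow := norm_su2Quat_seamField_transport_sub_le hG 1 (x 1).val b
  rw [plane_site_eq_iterate_row hx, ← hR] at hrow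
  have hsplit : (C * R)⁻¹ * g 0 * (C * R) = R⁻¹ * (C⁻¹ * g 0 * C) * R := by group
  rw [hsplit]
  have hmid : ‖su2Quat (R⁻¹ * g b * R) - su2Quat (R⁻¹ * (C⁻¹ * g 0 * C) * R)‖ ≤ (x 2).val * τ := by
    rw [norm_su2Quat_conj_sub_conj]; exact hcol
  have hy : ((x 1).val : ℝ) * τ ≤ L * τ := mul_le_mul_of_nonneg_right (by exact_mod_cast (ZMod.val_lt (x 1)).le) hτ
  have hz : ((x 2).val : ℝ) * τ ≤ L * τ := mul_le_mul_of_nonneg_right (by exact_mod_cast (ZMod.val_lt (x 2)).le) hτ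
  calc _ ≤ ‖su2Quat (g x) - su2Quat (R⁻¹ * g b * R)‖ + ‖su2Quat (R⁻¹ * g b * R) - su2Quat (R⁻¹ * (C⁻¹ * g 0 * C) * R)‖ := by
        rw [← sub_add_sub_cancel (su2Quat (g x)) (su2Quat (R⁻¹ * g b * R)) (su2Quat (R⁻¹ * (C⁻¹ * g 0 * C) * R))]
        exact norm_add_le _ _
    _ ≤ (x 1).val * τ + (x 2).val * τ := add_le_add hrow hmid
    _ ≤ 2 * (L * τ) := by linarith

/-- ★ **Seam defect bound**: if `g · U` is linkwise `τ`-close to `U` then for every plane site `x`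
`‖q(h x) − q(g(x) h(x) g(x)⁻¹)‖ ≤ ‖q_{h₀} q_{g₀} − q_{g₀} q_{h₀}‖ + 4Lτ|θ| ≤ 2χ₀|θ| + 4Lτ|θ|`. [cite: Luscher1983, §2] -/
theorem norm_seamDefect_le (θ : ℝ) {χ₀ σ₁ τ : ℝ} (hχ : 0 < χ₀) (hσ : 0 < σ₁) {g : Site 3 L → SU2} {U : GaugeConfig 3 L SU2}
    (hG : ∀ e : Edge 3 L, ‖su2Quat (gaugeTransform g U e) - su2Quat (U e)‖ ≤ τ) {x : Site 3 L} (hx : x 0 = 0) :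
    ‖su2Quat (gAxisField θ χ₀ σ₁ g U x) - su2Quat (g x * gAxisField θ χ₀ σ₁ g U x * (g x)⁻¹)‖ ≤ 2 * χ₀ * |θ| + 4 * (L * τ) * |θ| := by
  rw [norm_sub_conj_eq_norm_comm]
  set W := sheetTransport U x with hW
  set h₀ := gAxisElt θ χ₀ σ₁ g U with hh₀
  have hθ1 : ‖su2Quat (gAxisField θ χ₀ σ₁ g U x) - 1‖ ≤ |θ| := norm_su2Quat_gAxisField_sub_one_le θ hχ hσ g U x
  -- replace `g x` by the transported `W⁻¹ g₀ W`
  have hg := norm_seamField_sub_transport_le hG hx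
  rw [← hW] at hg
  have hdiff := norm_comm_sub_comm_le (su2Quat (g x)) (su2Quat (W⁻¹ * g 0 * W)) (su2Quat (gAxisField θ χ₀ σ₁ g U x))
  -- the transported commutator is the one at the origin
  have h0 : ‖su2Quat (gAxisField θ χ₀ σ₁ g U x) * su2Quat (W⁻¹ * g 0 * W) - su2Quat (W⁻¹ * g 0 * W) * su2Quat (gAxisField θ χ₀ σ₁ g U x)‖ =
      ‖su2Quat h₀ * su2Quat (g 0) - su2Quat (g 0) * su2Quat h₀‖ := by
    rw [gAxisField_apply, ← hW, ← hh₀]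
    exact norm_comm_conj W h₀ (g 0)
  have hseam := norm_comm_gAxisElt_seam_le θ hχ hσ g U
  rw [← hh₀] at hseam
  -- assemble: `[h, g x] = [h, g̃] + ([h, g x] − [h, g̃])`, the latter `≤ 2‖g x − g̃‖‖h − 1‖`
  have h1 : ‖su2Quat (gAxisField θ χ₀ σ₁ g U x) * su2Quat (g x) - su2Quat (g x) * su2Quat (gAxisField θ χ₀ σ₁ g U x)‖ ≤
      ‖su2Quat (gAxisField θ χ₀ σ₁ g U x) * su2Quat (W⁻¹ * g 0 * W) - su2Quat (W⁻¹ * g 0 * W) * su2Quat (gAxisField θ χ₀ σ₁ g U x)‖ +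
        2 * ‖su2Quat (g x) - su2Quat (W⁻¹ * g 0 * W)‖ * ‖su2Quat (gAxisField θ χ₀ σ₁ g U x) - 1‖ := by
    have hd := norm_comm_sub_comm_le' (su2Quat (g x)) (su2Quat (W⁻¹ * g 0 * W)) (su2Quat (gAxisField θ χ₀ σ₁ g U x))
    have h := norm_add_le (su2Quat (gAxisField θ χ₀ σ₁ g U x) * su2Quat (W⁻¹ * g 0 * W) - su2Quat (W⁻¹ * g 0 * W) * su2Quat (gAxisField θ χ₀ σ₁ g U x))
      ((su2Quat (gAxisField θ χ₀ σ₁ g U x) * su2Quat (g x) - su2Quat (g x) * su2Quat (gAxisField θ χ₀ σ₁ g U x)) -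
        (su2Quat (gAxisField θ χ₀ σ₁ g U x) * su2Quat (W⁻¹ * g 0 * W) - su2Quat (W⁻¹ * g 0 * W) * su2Quat (gAxisField θ χ₀ σ₁ g U x)))
    rw [add_sub_cancel] at h
    exact h.trans (add_le_add le_rfl hd)
  have h2 : 2 * ‖su2Quat (g x) - su2Quat (W⁻¹ * g 0 * W)‖ * ‖su2Quat (gAxisField θ χ₀ σ₁ g U x) - 1‖ ≤ 2 * (2 * (L * τ)) * |θ| :=
    mul_le_mul (mul_le_mul_of_nonneg_left hg (by norm_num)) hθ1 (norm_nonneg _) (by linarith [norm_nonneg (su2Quat (g x) - su2Quat (W⁻¹ * g 0 * W))])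
  rw [h0] at h1
  linarith

end Summit.QuantumFields.YangMills.Theorems.FemtoTransferGap.GAxis

end
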